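import Mathlib.MeasureTheory.Function.SpecialFunctions.Inner
import Literature.MathematicalPhysics.KineticTheory.HardSphereEuler
import HarnessLib

/-!
# Joint measurability of the collision-difference mark `ψ_T` (line `Sketch` v8, crux
# `LambertianContactSwap.ContactAngleEquidistribution`, stmt-AtomisticToContinuum-12097)

Helper file (`--supports stmt-AtomisticToContinuum-12097`, registered stub `stub_psiT_measurable`).
For a continuous linear map `T : ℝ³ →L[ℝ] ℝ³` and the quadratic velocity observable `q(v) = ⟪v, T v⟫`, the
collision difference `Dq_T(v, w, ω) = q(v − ⟪v − w, ω⟫ ω) + q(w + ⟪v − w, ω⟫ ω) − q(v) − q(w)` is a continuous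
function of `(v, w, ω)`, and the mark `ψ_T(s, x, v, w, n) = Dq_T(v, w, n̂) / (12 ‖v − w‖²)` with
`n̂ = ‖n‖⁻¹ • n` (Lean's total inverse, `0⁻¹ = 0`) is jointly Borel measurable in
`(s, x, v, w, n) ∈ ℝ × 𝕋³ × ℝ³ × ℝ³ × ℝ³`: after unfolding, it is an explicit composition of inner products, `T`,
norms, total inverses, scalar multiplications, products, sums and differences of the (measurable) coordinates.

References: folklore (Mathlib measurability API: `Measurable.inv`, `Measurable.smul`, `Continuous.measurable`).
-/

noncomputable section

open MeasureTheory
open scoped RealInnerProductSpace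

namespace Summit.AtomisticToContinuum.HydrodynamicLimit.Theorems.ContactAngleEquidistributionSketch

open Literature.MathematicalPhysics.KineticTheory

/-- Joint measurability of the collision-difference mark: for `T : ℝ³ →L[ℝ] ℝ³`, `q(v) = ⟪v, T v⟫`,
`Dq_T(v, w, ω) = q(v − ⟪v − w, ω⟫ ω) + q(w + ⟪v − w, ω⟫ ω) − q(v) − q(w)` and `n̂ = ‖n‖⁻¹ • n`, the mark
`ψ_T(s, x, v, w, n) = Dq_T(v, w, n̂) / (12 ‖v − w‖²)` is measurable on `ℝ × 𝕋³ × ℝ³ × ℝ³ × ℝ³`. [folklore] -/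
theorem stub_psiT_measurable (T : V3 →L[ℝ] V3) :
    let refl : V3 → V3 × V3 → V3 × V3 := fun n p =>
      (p.1 - ⟪p.1 - p.2, n⟫ • n, p.2 + ⟪p.1 - p.2, n⟫ • n)
    let Dq : V3 → V3 → V3 → ℝ := fun v w n =>
      ⟪(refl n (v, w)).1, T (refl n (v, w)).1⟫ + ⟪(refl n (v, w)).2, T (refl n (v, w)).2⟫ -
        ⟪v, T v⟫ - ⟪w, T w⟫
    let ψ : ℝ → T3 → V3 → V3 → V3 → ℝ := fun _ _ v w n =>
      (12 * ‖v - w‖ ^ 2)⁻¹ * Dq v w (‖n‖⁻¹ • n)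
    Measurable (fun p : ℝ × T3 × V3 × V3 × V3 => ψ p.1 p.2.1 p.2.2.1 p.2.2.2.1 p.2.2.2.2) := by
  intro refl Dq ψ
  -- Unfold the three `let`s: what remains is an explicit expression in the coordinates of `p`, built from
  -- inner products, `T`, `‖·‖`, the total inverse `x⁻¹`, `•`, `*`, `+`, `-`; `fun_prop` composes the
  -- measurability lemmas (`Measurable.inner/norm/inv/smul/mul/add/sub`, continuity of `T`).
  simp only [ψ, Dq, refl]
  fun_prop

end Summit.AtomisticToContinuum.HydrodynamicLimit.Theorems.ContactAngleEquidistributionSketch
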